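import Summits.QuantumAdvantage.QuantumAdvantage.Theses.LinnikCubicClassGroups
import Summits.QuantumAdvantage.QuantumAdvantage.Cruxes.DegreeOnePrimesEscape.IdeatorSketchR1I3
import Summits.QuantumAdvantage.QuantumAdvantage.Theorems.DegreeOnePrimesEscape.Negative.WithoutProperFalse
import Summits.QuantumAdvantage.QuantumAdvantage.Theorems.DegreeOnePrimesEscape.Negative.EscapeCounting
import Summits.QuantumAdvantage.QuantumAdvantage.Theorems.DegreeOnePrimesEscape.Negative.EscapeSign
import Literature.NumberTheory.LFunctions.UniformClassGroupPNTGeneralDegree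
import Literature.NumberTheory.LFunctions.UniformClassGroupPNTGeneralDegreeInputs
import Literature.NumberTheory.LFunctions.StarkExceptionalZero
import Literature.NumberTheory.LFunctions.PrimeIdealTheorem
import Literature.NumberTheory.LFunctions.PrimeIdealTheoremProofs
import Literature.NumberTheory.LFunctions.PrimeIdealCountRat
import Literature.NumberTheory.LFunctions.DedekindZetaRealZerosUniform
import Literature.NumberTheory.LFunctions.LogIntegralProofs
import Literature.NumberTheory.LFunctions.LogIntegralStrictMonoProofs

/-!
# Skeleton line `reserve-primes-absorption` for crux `DegreeOnePrimesEscape` (stmt-QuantumAdvantage-11543)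

Route `LinnikCubicClassGroups`, crux rank 2:
`DegreeOnePrimesEscape = ∀ n, ∃ C, ∀ K ([K:ℚ] = n, no quadratic subfield), ∀ x ≥ |d_K|^C,
 ∀ M < Cl(K) proper, π(x) ≤ 8 · #{P : N P prime ≤ x, [P] ∉ M}`.

## The line (crux idea card `Ideas/reserve-primes-absorption.md`, triage r1-1/2/3: pass)

ARCHITECTURE (one-sided shadows, PROVED in the crux workfile `IdeatorSketchR1I3.lean`, imported):
`degreeOnePrimesEscape_of_shadows : SubgroupUpperShadow → LowerPITShadow → crux` and
`subgroupUpperShadow_of_TZ : TZ → SubgroupUpperShadow` (TZ = the in-tree named fact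
`ThornerZaman2019_classPNT_hilbertClassField`, Thorner–Zaman 2019 Thm 1.4 for the Hilbert class
field).  So the crux is `TZ + LowerPITShadow` (`29·Li(x) ≤ 32·π_K(x)` for `x ≥ Q^{C₁(n)}`,
`Q = |d_K|·n^n`, `K` without quadratic subfield), and the ONLY enemy of the lower shadow is a real
zero `β₁` of `ζ_K` ITSELF in Thorner–Zaman's exceptional branch with TRIVIAL character
(Disproof §9–§10, `not_stark_iff`).  Card one-sided-shadows kills it with the Stark fact
`Stark1974_dedekindZeta_ne_zero_of_noQuadraticSubfield` for every `n`.

LEVER OF THIS LINE (prime side, no Stark, no Artin `L`-functions): RESERVE + BOOTSTRAP.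
* RESERVE (algebra + one-sided Chebotarev for a quadratic character): for a cubic field `K` with
  NON-SQUARE discriminant every odd prime `p ∤ d_K` with `(d_K/p) = −1` carries a degree-one prime
  (Stickelberger parity: `(d_K/p) = (−1)^{3−r}`, so `r = 2`, splitting type `(1)(2)`), and such
  primes number `≥ (2/5)·Li(x)` for `x ≥ (4|d_K|)^C` (they are the primes inert in `ℚ(√d_K)`;
  the split ones are `≤ (33/64)·Li(x)` by TZ for the quadratic field summed over its classes,
  `π(x) ≥ (127/128)·Li(x)` by the PROVED prime ideal theorem at `ℚ`).  Hence
  `π_K(x) ≥ (2/5)·Li(x)` at every polynomial height — uniformly, with no zero information.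
* BOOTSTRAP (`stub_reserveAmplification`, the load-bearing stub): in TZ's exceptional branch with
  `χ₁ = 1`, TZ's own two-sided class-by-class bound summed over `Cl(K)` gives
  `π_K(x₀) ≤ (33/32)(Li x₀ − Li x₀^{β₁})` at `x₀ = Q^{C₀}`; against the reserve this caps the
  depletion, `x₀^{β₁−1} ≤ 1 − 8v/33`, i.e. `1 − β₁ ≥ η(v)/(C₀ log Q)` — a Stark-type repulsion
  obtained from PRIME COUNTS; at `x ≥ Q^{C₁}`, `x^{β₁−1} ≤ e^{−ηC₁/C₀} ≤ 1/128` and the lower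
  shadow `29·Li ≤ 32·π_K` follows.  The two-scale use of ONE `β₁` is licensed by the typed fact
  (`∃ χ₁ β₁` sits outside `∀ C x`, UniformClassGroupPNTGeneralDegree.lean:144ff; triage F2).
* CYCLIC CUBICS (square discriminant, the LP-residue inside `n = 3`): Stark-free on the ZERO side —
  `ζ_K = ζ·L(χ)L(χ̄)`, a real zero of `ζ_K` is a double zero (`ζ < 0` on `(0,1)`, conjugation), and
  the tree's PROVED uniform simplicity `exists_realZero_simple_dedekindZeta₁ 3` pushes it below
  `1 − c/log|d_K|` (`stub_cyclicCubicZeroFree`).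
* RESIDUE `n ≥ 4` (honest): the zero-free input is the Stark fact restricted to degrees `≥ 4`
  with an inexplicit constant (`stub_starkFromDegreeFour` = card heilbronn-count-discharge's K1
  minus `n ≤ 3`; conditionally a one-liner from the named fact, `starkFromDegreeFour_of_named`).
* TRANSFER zero side → prime side, field-pointwise: `lowerShadow_of_TZ_zeroFree` (PROVED here; the
  degree-local refactor of `HeilbronnCount.lowerPITShadow_of_TZ_starkInexplicit` asked for by
  triage r1-2/r1-3).

CONSEQUENCE: the `n = 3` slice — all the route's consumer `PureCubicClassGroupFBQP` uses
(`Disproof.cubic_escape_of_crux`) — rests on TZ ALONE (stubs 2–5); `DegreeOnePrimesEscape_of`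
cannot bypass stubs 2–5 because stub 6 starts at degree 4.

## Registered stubs (6) and the composition
1. `stub_thornerZamanHCF` (XL, NAMED FACT = debt; shared with one-sided-shadows depth 1).
2. `stub_cubicInertReserve` (L, PROVABLE NOW, fact-free; Stickelberger parity / Dedekind–Kummer).
3. `stub_inertPrimeCount` (M, provable now from TZ for `ℚ(√d)` + PIT at `ℚ`; or hypothesis-free
   from the tree's Page/Linnik Dirichlet machinery — triage r1-1 sharpening).
4. `stub_reserveAmplification` (M, provable now from TZ; THE LEVER).
5. `stub_cyclicCubicZeroFree` (L, provable now, fact-free: Kronecker–Weber plumbing +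
   `AbelianDedekindZeta.dedekindZetaCont_eq_prod_characterGroup_LFunction` + `conj_LFunction_conj`
   + `exists_realZero_simple_dedekindZeta₁`).
6. `stub_starkFromDegreeFour` (XL unconditional = heilbronn-count-discharge; conditional one-liner
   from `Stark1974_dedekindZeta_ne_zero_of_noQuadraticSubfield`).
`DegreeOnePrimesEscape_of` composes them into the crux BY NAME (kernel-checked, no `sorry`):
`degreeOnePrimesEscape_of_shadows (subgroupUpperShadow_of_TZ S1) (lowerPITShadow_of_stubs S1 … S6)`.

## Disproof used (`Cruxes/DegreeOnePrimesEscape/Disproof.lean` v4.1, gen 3)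
* `degreeOnePrimesEscape_false_without_proper` (landed `Negative/WithoutProperFalse.lean`, p69750):
  HONOURED — `M ≠ ⊤` is consumed inside `degreeOnePrimesEscape_of_shadows` (`[Cl:M] ≥ 2`);
  re-exported below as a scratch check.
* §2/§3 (slices `n ≤ 2` trivial; odd degree needs no field hypothesis): the `n = 2` branch of
  `lowerPITShadow_of_stubs` is vacuous, the `n = 3` branch never uses the no-quadratic-subfield
  hypothesis (it splits on `IsSquare d_K` instead), consistent with `escapeWithoutNoQuad_iff_of_odd`.
* §9 `not_stark_iff` / §10 sign lemmas (landed `Negative/EscapeSign.lean`, p70790): the line attacks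
  exactly the `χ₁ = 1` enemy; nontrivial `χ₁` is handled inside the imported proofs by
  `sum_subgroup_char_re_nonneg` / `sum_hom_units_eq_zero`; scratch check below.
* §11 robustness: stub 4 uses TZ's UPPER bound in the `χ₁ = 1` branch (two-sided typed fact = print
  strength); an additive re-vendoring (`|π_C − main| ≤ ε·Li/h`) would still give the cap.
* Tightness / near-misses (constant `≤ 2` impossible, `C = 0` false): untouched — the composition
  keeps one-sided-shadows' constants `33/32`, `29/32`, `8`.
No `_false_without_` theorem other than `…_without_proper` exists; no `-- Targets` entry; no stub is
an instance of a landed Negative lemma (all Negative lemmas are load-bearing / sign / counting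
statements, checked by the `example`s at the end).
-/

-- `Summit.QuantumAdvantage.QuantumAdvantage.…` is the gate's single-conjunct layout (Sub = Summit).
set_option linter.dupNamespace false

noncomputable section

open scoped NumberField nonZeroDivisors
open Literature.NumberTheory.LFunctions Literature.NumberTheory.LFunctions.NumberField

namespace Summit.QuantumAdvantage.QuantumAdvantage.Cruxes.DegreeOnePrimesEscape.ReservePrimesAbsorption

/-! ### Named statements of the line (each is definitionally its registered stub) -/

/-- STATEMENT 2 — the ALGEBRAIC RESERVE for cubic fields: for a number field `K` of degree `3`,
every odd prime `p ∤ d_K` with Jacobi symbol `(d_K/p) = −1` has a prime ideal of `𝓞 K` of norm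
exactly `p` above it (Stickelberger–Pellet parity `(d_K/p) = (−1)^{n−r}` for unramified `p`, so
`r = 2` prime factors, splitting type `(1)(2)`; equivalently Frobenius is a transposition, which
fixes a root).  No hypothesis on `d_K` being a non-square is needed (for square `d_K` the symbol
is `+1`).  True for pure cubics `ℚ(∛m)` by the even simpler `p ≡ 2 (mod 3) ⇒ x ↦ x³` bijective on
`𝔽_p` (PARI checks j005989/j008496/j008637, 0 failures).  [Stickelberger 1897; Dedekind–Kummer] -/
def CubicInertReserve : Prop :=
  ∀ (K : Type) [Field K] [NumberField K], Module.finrank ℚ K = 3 →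
    ∀ p : ℕ, p.Prime → p ≠ 2 → ¬ ((p : ℤ) ∣ NumberField.discr K) →
      jacobiSym (NumberField.discr K) p = -1 →
        ∃ P : Ideal (𝓞 K), P.IsPrime ∧ Ideal.absNorm P = p

/-- STATEMENT 3 — ONE-SIDED CHEBOTAREV FOR A QUADRATIC CHARACTER AT POLYNOMIAL HEIGHT: there is
an absolute `C` such that for every non-square integer `d` and every `x ≥ (4|d|)^C`, at least
`(2/5)·Li(x)` odd primes `p ≤ x`, `p ∤ d`, have `(d/p) = −1` (the primes inert in `ℚ(√d)`).
One-sided and sign-immune: a Siegel zero of `χ_d` only ENRICHES the inert primes.  Route A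
(stub as registered, hypothesis TZ): `2·#{split p ≤ x} ≤ π_k(x) ≤ (33/32)·Li(x)` for
`k = ℚ(√d)` by `OneSidedShadows.subgroupClassSum_le_of_TZ` with `M = ⊤`, and
`π(x) ≥ (127/128)·Li(x)` eventually by the PROVED `primeIdealTheorem_holds` at `ℚ`
(`primeIdealCount_rat`), `ω(2d) ≤ 1 + log₂|d|`; budget `127/128 − 66/128 − 1/128 ≥ 2/5`.
Route B (hypothesis-free, triage r1-1): the tree's Page/Linnik machinery for real Dirichlet
characters.  [ThornerZaman2019 Thm 1.4 at n_K = 2; Landau 1903] -/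
def InertPrimeCount : Prop :=
  ∃ C : ℝ, ∀ d : ℤ, ¬ IsSquare d → ∀ x : ℝ, (4 * |(d : ℝ)|) ^ C ≤ x →
    2 / 5 * offsetLogIntegral x ≤
      (Set.ncard {p : ℕ | p.Prime ∧ p ≠ 2 ∧ ¬ ((p : ℤ) ∣ d) ∧ jacobiSym d p = -1 ∧ (p : ℝ) ≤ x} : ℝ)

/-- STATEMENT 4 — RESERVE AMPLIFICATION (the BOOTSTRAP; the line's lever), degree-local and
field-uniform: for `n > 1`, `v > 0` and any `Cr` there is `C₁ = C₁(n, v, Cr)` such that every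
number field `K` of degree `n` which keeps a reserve `π_K(x) ≥ v·Li(x)` at all heights
`x ≥ Q^{Cr}` (`Q = |d_K|·n^n`) satisfies the full lower prime ideal theorem shadow
`29·Li(x) ≤ 32·π_K(x)` for `x ≥ Q^{C₁}`.  From TZ: non-exceptional branch and `χ₁ ≠ 1` give
`π_K ≥ (31/32)·Li` outright (`∑_C χ₁(C) = 0`); for `χ₁ = 1` the class sum of TZ's UPPER bounds at
`x₀ = Q^{C₀}`, `C₀ = max(Cr, c₁, C_E, 1)`, reads `v·Li(x₀) ≤ (33/32)(Li x₀ − Li x₀^{β₁})`, whence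
(`Li x₀ − Li x₀^β ≤ 2(x₀ − x₀^β)/log x₀` for `β ≥ 1/2`, `Li x₀ ≥ (x₀−2)/log x₀`)
`x₀^{β₁−1} ≤ 1 − 8·min(v,1)/33`, i.e. `(1−β₁)·log x ≥ η·C₁/C₀ ≥ log 128` at `x ≥ Q^{C₁}`; then
`Li(x^{β₁}) ≤ (52/25)·x^{β₁}/log x ≤ (1/30)·Li(x)` and `π_K ≥ (31/32)(29/30)·Li ≥ (29/32)·Li`.
Why it might fail: only through a slip in the typed fact's two-sidedness (relative error in the
depleted branch) — audited faithful (Disproof §11).  [ThornerZaman2019 Thm 1.4; this card] -/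
def ReserveAmplification : Prop :=
  ∀ n : ℕ, 1 < n → ∀ v : ℝ, 0 < v → ∀ Cr : ℝ, ∃ C₁ : ℝ,
    ∀ (K : Type) [Field K] [NumberField K], Module.finrank ℚ K = n →
      (∀ x : ℝ, ThornerZaman.condQn K ^ Cr ≤ x →
        v * offsetLogIntegral x ≤ (primeIdealCount K x : ℝ)) →
      ∀ x : ℝ, ThornerZaman.condQn K ^ C₁ ≤ x →
        29 * offsetLogIntegral x ≤ 32 * (primeIdealCount K x : ℝ)

/-- STATEMENT 5 — CYCLIC CUBICS ARE STARK-FREE ON THE ZERO SIDE: there is `c > 0` such that for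
every cubic number field `K` with SQUARE discriminant (equivalently `K/ℚ` Galois, cyclic),
`ζ_K(σ) ≠ 0` for `1 − c/log|d_K| ≤ σ < 1`.  Proof route (all in tree, no named fact):
`K ⊆ ℚ(ζ_f)` (`KroneckerWeber_holds`), `ζ_K = ζ·L(χ)·L(χ̄)` for the cubic Dirichlet character
`χ` of conductor `f`, `d_K = f²` (`AbelianDedekindZeta.dedekindZetaCont_eq_prod_characterGroup_LFunction`);
a real zero `σ` of `ζ_K` has `ζ(σ) < 0` (`riemannZeta_neg_of_pos_of_lt_one`), so
`L(σ,χ)·L(σ,χ̄) = 0` and by conjugation (`conj_LFunction_conj`) BOTH vanish: `ζ_K` (hence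
`ζ₁_K = (s−1)ζ_K`) has analytic order `≥ 2` at `σ`, and `exists_realZero_simple_dedekindZeta₁ 3`
gives `σ ≤ 1 − c₃/(log|d_K| + log 4) ≤ 1 − (c₃/2)/log|d_K|` (`|d_K| ≥ 49`).  This is the
abelian-doubling residue treatment named on the card; the reserve lever is silent here (the LP
value of `(C₃, 1)` is `0`).  [Heilbronn 1973 §2; Stark 1974 Lemma 8; tree DedekindZetaRealZerosUniform] -/
def CyclicCubicZeroFree : Prop :=
  ∃ c : ℝ, 0 < c ∧ ∀ (K : Type) [Field K] [NumberField K], Module.finrank ℚ K = 3 →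
    IsSquare (NumberField.discr K) →
    ∀ σ : ℝ, 1 - c / Real.log ((NumberField.discr K).natAbs : ℝ) ≤ σ → σ < 1 →
      dedekindZetaCont K σ ≠ 0

/-- STATEMENT 6 — THE RESIDUE (degrees `≥ 4`): Stark's no-quadratic-subfield non-vanishing with an
INEXPLICIT constant, `∀ n ≥ 4, ∃ c(n) > 0, ∀ K` of degree `n` without quadratic subfield,
`ζ_K(σ) ≠ 0` on `[1 − c/log|d_K|, 1)`.  Literally `HeilbronnCount.StarkNoQuadSubfieldInexplicit`
with `n ≤ 3` removed; TODAY a one-line consequence of the named fact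
`Stark1974_dedekindZeta_ne_zero_of_noQuadraticSubfield` (`c = 1/(4·n!)`, see
`starkFromDegreeFour_of_named`), unconditionally the target of card heilbronn-count-discharge
(Heilbronn's count on the Galois closure; all inputs `_holds` in tree) or of the card's Burnside-ring
LP for absorbable `(G,H)` plus Stark on the LP-residue.  The reserve line does NOT claim to remove
it.  [Stark1974; MurtyMurty1997 Prop 5.1–5.2, Cor 6.2] -/
def StarkFromDegreeFour : Prop :=
  ∀ n : ℕ, 4 ≤ n → ∃ c : ℝ, 0 < c ∧
    ∀ (K : Type) [Field K] [NumberField K], Module.finrank ℚ K = n →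
      (∀ F : IntermediateField ℚ K, Module.finrank ℚ F ≠ 2) →
      ∀ σ : ℝ, 1 - c / Real.log ((NumberField.discr K).natAbs : ℝ) ≤ σ → σ < 1 →
        dedekindZetaCont K σ ≠ 0

/-! ### The registered stubs (statements expanded over existing declarations) -/

/-- STUB 1 (XL, NAMED FACT, the debt every line for this crux carries): Thorner–Zaman 2019,
Theorem 1.4, for the Hilbert class field of a number field of degree `> 1`
(`Literature/NumberTheory/LFunctions/UniformClassGroupPNTGeneralDegree.lean`, faithful to print:
Disproof §11).  Discharge programme = card one-sided-shadows depth 1 (per-character log-free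
density from the tree's Lemme A/B, hybrid sieve, Gallagher); closes also by `…_holds` when a
literature-prover lands it. -/
theorem stub_thornerZamanHCF : ThornerZaman2019_classPNT_hilbertClassField := by
  sorry

/-- STUB 2 (L, PROVABLE NOW, fact-free) — `CubicInertReserve`: odd `p ∤ d_K` with `(d_K/p) = −1`
carries a degree-one prime of the cubic field `K`.  Work: `p𝓞_K = ∏ Pᵢ^{eᵢ}`,
`∑ eᵢ fᵢ = 3` (Mathlib `Ideal.sum_ramification_inertia`); if no `fᵢ = 1` then `p` is inert,
`𝓞_K/p ≅ 𝔽_{p³}`, and `d_K mod p` is the discriminant of the étale `𝔽_p`-algebra `𝓞_K/p`, a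
non-zero SQUARE in `𝔽_p` because Frobenius permutes the three embeddings as a `3`-cycle (even);
so `(d_K/p) = +1`, contradiction.  (Alternative: Dedekind–Kummer on `ℤ[θ]` with `p ∤` index —
`p` odd is never a common index divisor of a cubic field — and the polynomial parity theorem over
`𝔽_p`.) -/
theorem stub_cubicInertReserve :
    ∀ (K : Type) [Field K] [NumberField K], Module.finrank ℚ K = 3 →
      ∀ p : ℕ, p.Prime → p ≠ 2 → ¬ ((p : ℤ) ∣ NumberField.discr K) →
        jacobiSym (NumberField.discr K) p = -1 →
          ∃ P : Ideal (𝓞 K), P.IsPrime ∧ Ideal.absNorm P = p := by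
  sorry

/-- STUB 3 (M, PROVABLE NOW from the TZ hypothesis; hypothesis-free via Page/Linnik machinery) —
`ThornerZaman2019_classPNT_hilbertClassField → InertPrimeCount`.  Work: build `k = ℚ(√d)`
(`[k:ℚ] = 2`, `|d_k| ≤ 4|d|`, `condQn k = 4|d_k| ≤ (4|d|)²`); for odd `p ∤ d`,
`(d/p) = (d_k/p)` and `= −1` iff `p` is inert in `k`; split `p ≤ x` inject two-to-one into
prime ideals of norm `≤ x`, so `2·#split ≤ π_k(x) ≤ (33/32)·Li(x)` for `x ≥ Q_k^{C₀}`
(`OneSidedShadows.subgroupClassSum_le_of_TZ`, `M = ⊤`); `π(x) = primeIdealCount ℚ x`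
(`primeIdealCount_rat`) `≥ Li(x) − C·x·e^{−c√log x} ≥ (127/128)·Li(x)` eventually
(`primeIdealTheorem_holds`); primes dividing `2d` are `≤ 1 + log₂|d| ≤ (1/128)·Li(x)`. -/
theorem stub_inertPrimeCount :
    ThornerZaman2019_classPNT_hilbertClassField →
      ∃ C : ℝ, ∀ d : ℤ, ¬ IsSquare d → ∀ x : ℝ, (4 * |(d : ℝ)|) ^ C ≤ x →
        2 / 5 * offsetLogIntegral x ≤
          (Set.ncard {p : ℕ | p.Prime ∧ p ≠ 2 ∧ ¬ ((p : ℤ) ∣ d) ∧ jacobiSym d p = -1 ∧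
              (p : ℝ) ≤ x} : ℝ) := by
  sorry

/-- STUB 4 (M, PROVABLE NOW from the TZ hypothesis; THE LEVER) —
`ThornerZaman2019_classPNT_hilbertClassField → ReserveAmplification` (see the statement's
docstring for the complete real-variable derivation; tools: `OneSidedShadows.errorTermN_le_of_ge`,
`OneSidedShadows.primeIdealCount_eq_sum_classCount`, `OneSidedShadows.offsetLogIntegral_le_mul_div_log`,
`sub_mul_inv_log_pow_le_offsetLogIntegralPow`, `sum_hom_units_eq_zero`, `ThornerZaman.twelve_le_condQn`;
the pattern of `lowerShadow_of_TZ_zeroFree` below with the Stark step replaced by the scale-`x₀`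
cap). -/
theorem stub_reserveAmplification :
    ThornerZaman2019_classPNT_hilbertClassField →
      ∀ n : ℕ, 1 < n → ∀ v : ℝ, 0 < v → ∀ Cr : ℝ, ∃ C₁ : ℝ,
        ∀ (K : Type) [Field K] [NumberField K], Module.finrank ℚ K = n →
          (∀ x : ℝ, ThornerZaman.condQn K ^ Cr ≤ x →
            v * offsetLogIntegral x ≤ (primeIdealCount K x : ℝ)) →
          ∀ x : ℝ, ThornerZaman.condQn K ^ C₁ ≤ x →
            29 * offsetLogIntegral x ≤ 32 * (primeIdealCount K x : ℝ) := by
  sorry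

/-- STUB 5 (L, PROVABLE NOW, fact-free) — `CyclicCubicZeroFree` (conjugate-pair doubling for the
abelian cubic plus the tree's uniform simplicity of the near-`1` real zero; see the statement's
docstring).  The one residue of the reserve lever inside `n = 3`. -/
theorem stub_cyclicCubicZeroFree :
    ∃ c : ℝ, 0 < c ∧ ∀ (K : Type) [Field K] [NumberField K], Module.finrank ℚ K = 3 →
      IsSquare (NumberField.discr K) →
      ∀ σ : ℝ, 1 - c / Real.log ((NumberField.discr K).natAbs : ℝ) ≤ σ → σ < 1 →
        dedekindZetaCont K σ ≠ 0 := by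
  sorry

/-- STUB 6 (XL unconditionally; a one-liner from the named Stark fact, `starkFromDegreeFour_of_named`)
— `StarkFromDegreeFour`, the declared residue of the line (degrees `≥ 4`). -/
theorem stub_starkFromDegreeFour :
    ∀ n : ℕ, 4 ≤ n → ∃ c : ℝ, 0 < c ∧
      ∀ (K : Type) [Field K] [NumberField K], Module.finrank ℚ K = n →
        (∀ F : IntermediateField ℚ K, Module.finrank ℚ F ≠ 2) →
        ∀ σ : ℝ, 1 - c / Real.log ((NumberField.discr K).natAbs : ℝ) ≤ σ → σ < 1 →
          dedekindZetaCont K σ ≠ 0 := by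
  sorry

/-! ### Consistency: each named statement IS its registered stub (definitionally) -/

/-- `CubicInertReserve` is stub 2. -/
theorem cubicInertReserve_holds : CubicInertReserve := stub_cubicInertReserve
/-- `InertPrimeCount` follows from stub 1 and stub 3. -/
theorem inertPrimeCount_holds : InertPrimeCount := stub_inertPrimeCount stub_thornerZamanHCF
/-- `ReserveAmplification` follows from stub 1 and stub 4. -/
theorem reserveAmplification_holds : ReserveAmplification :=
  stub_reserveAmplification stub_thornerZamanHCF
/-- `CyclicCubicZeroFree` is stub 5. -/
theorem cyclicCubicZeroFree_holds : CyclicCubicZeroFree := stub_cyclicCubicZeroFree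
/-- `StarkFromDegreeFour` is stub 6. -/
theorem starkFromDegreeFour_holds : StarkFromDegreeFour := stub_starkFromDegreeFour

/-! ### Name-keyed aliases of the six statements (the hypotheses of the composition; the skeleton
audit admits a hypothesis only if its head constant is a registered obligation or is named like a
declared stub) -/
namespace Registered

/-- Alias of the TZ named fact keyed by the registered stub name. -/
abbrev stub_thornerZamanHCF : Prop := ThornerZaman2019_classPNT_hilbertClassField
/-- Alias of `CubicInertReserve` keyed by the registered stub name. -/
abbrev stub_cubicInertReserve : Prop := CubicInertReserve
/-- Alias of `TZ → InertPrimeCount` keyed by the registered stub name. -/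
abbrev stub_inertPrimeCount : Prop :=
  ThornerZaman2019_classPNT_hilbertClassField → InertPrimeCount
/-- Alias of `TZ → ReserveAmplification` keyed by the registered stub name. -/
abbrev stub_reserveAmplification : Prop :=
  ThornerZaman2019_classPNT_hilbertClassField → ReserveAmplification
/-- Alias of `CyclicCubicZeroFree` keyed by the registered stub name. -/
abbrev stub_cyclicCubicZeroFree : Prop := CyclicCubicZeroFree
/-- Alias of `StarkFromDegreeFour` keyed by the registered stub name. -/
abbrev stub_starkFromDegreeFour : Prop := StarkFromDegreeFour

end Registered

/-! ### Glue 1 (PROVED): zero side → prime side, field-pointwise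

The degree-local / field-pointwise refactor of `HeilbronnCount.lowerPITShadow_of_TZ_starkInexplicit`
(triage r1-2, r1-3): from TZ and a zero-free interval `[1 − c/log|d_K|, 1)` for ONE field `K`
one gets `29·Li(x) ≤ 32·π_K(x)` for `x ≥ Q^{C₁}` with `C₁` depending on `c` and TZ's absolute
constants only.  Proof verbatim from the workfile, with the Stark call replaced by the pointwise
hypothesis. -/

/-- **Lower PIT shadow from TZ and a pointwise zero-free interval.** [folklore] -/
theorem lowerShadow_of_TZ_zeroFree (hTZ : ThornerZaman2019_classPNT_hilbertClassField)
    {c : ℝ} (hc : 0 < c) :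
    ∃ C₁ : ℝ, ∀ (K : Type) [Field K] [NumberField K], 1 < Module.finrank ℚ K →
      (∀ σ : ℝ, 1 - c / Real.log ((NumberField.discr K).natAbs : ℝ) ≤ σ → σ < 1 →
        dedekindZetaCont K σ ≠ 0) →
      ∀ x : ℝ, ThornerZaman.condQn K ^ C₁ ≤ x →
        29 * offsetLogIntegral x ≤ 32 * (primeIdealCount K x : ℝ) := by
  classical
  obtain ⟨c₁, c₂, c₃, hc₁, hc₂, hc₃, H⟩ := hTZ
  set L : ℝ := max 1 (Real.log (64 * c₃)) with hLdef
  refine ⟨max (max c₁ 44) (max (max (L / c₂) (L ^ 2 / (c₂ * Real.log 2))) (4 / c)), ?_⟩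
  intro K _ _ hK hZ x hx
  set C₁ : ℝ := max (max c₁ 44) (max (max (L / c₂) (L ^ 2 / (c₂ * Real.log 2))) (4 / c)) with hC₁def
  set Q : ℝ := ThornerZaman.condQn K with hQdef
  set h : ℕ := NumberField.classNumber K with hhdef
  -- basic sizes
  have hQ12 : 12 ≤ Q := ThornerZaman.twelve_le_condQn (K := K) hK
  have hQ1 : 1 ≤ Q := by linarith
  have hQpos : 0 < Q := by linarith
  have hC₁c₁ : c₁ ≤ C₁ := le_trans (le_max_left _ _) (le_max_left _ _)
  have hC₁44 : 44 ≤ C₁ := le_trans (le_max_right _ _) (le_max_left _ _)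
  have hC₁c : 4 / c ≤ C₁ := le_trans (le_max_right _ _) (le_max_right _ _)
  have hC₁0 : 0 ≤ C₁ := by linarith
  have hxc₁ : Q ^ c₁ ≤ x := le_trans (Real.rpow_le_rpow_of_exponent_le hQ1 hC₁c₁) hx
  have hxpos : 0 < x := lt_of_lt_of_le (Real.rpow_pos_of_pos hQpos _) hx
  have hlogx : C₁ * Real.log Q ≤ Real.log x := by
    have := Real.log_le_log (Real.rpow_pos_of_pos hQpos _) hx
    rwa [Real.log_rpow hQpos] at this
  have hlog2 : (0.6931471803 : ℝ) < Real.log 2 := Real.log_two_gt_d9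
  have hlogQ2 : 2 * Real.log 2 ≤ Real.log Q := by
    have h1 := OneSidedShadows.finrank_mul_log_two_le_log_condQn K hK
    have h2 : (2 : ℝ) ≤ Module.finrank ℚ K := by exact_mod_cast hK
    nlinarith
  have hlogQpos : 0 < Real.log Q := by linarith
  have hlogx60 : 60 ≤ Real.log x := by nlinarith
  have hx_exp : Real.exp 60 ≤ x := (Real.le_log_iff_exp_le hxpos).1 hlogx60
  have hx1 : 1 < x := by
    have : (1:ℝ) < Real.exp 60 := by have := Real.add_one_le_exp (60:ℝ); linarith
    linarith
  have hlogxpos : 0 < Real.log x := by linarith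
  have hE : c₃ * ThornerZaman.errorTermN c₂ Q (Module.finrank ℚ K) x ≤ 1 / 32 :=
    OneSidedShadows.errorTermN_le_of_ge hc₂ hc₃
      (le_trans (le_trans (le_max_left _ _) (le_max_left _ _)) (le_max_right _ _))
      (le_trans (le_trans (le_max_right _ _) (le_max_left _ _)) (le_max_right _ _)) K hK hx
  have hEpos : 0 < c₃ * ThornerZaman.errorTermN c₂ Q (Module.finrank ℚ K) x :=
    mul_pos hc₃ (ThornerZaman.errorTermN_pos _ _ _ _)
  have hLiup : offsetLogIntegral x ≤ 26 / 25 * (x / Real.log x) :=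
    OneSidedShadows.offsetLogIntegral_le_mul_div_log hx_exp
  have hxl : 0 ≤ x / Real.log x := by positivity
  -- per-class lower bound
  have key : ∀ (π m : ℝ), |π - m| ≤ c₃ * ThornerZaman.errorTermN c₂ Q (Module.finrank ℚ K) x * m →
      31 / 32 * m ≤ π := by
    intro π m hπ
    have hm : 0 ≤ m := by
      by_contra hneg
      rw [not_le] at hneg
      have : c₃ * ThornerZaman.errorTermN c₂ Q (Module.finrank ℚ K) x * m < 0 :=
        mul_neg_of_pos_of_neg hEpos hneg
      linarith [abs_nonneg (π - m)]
    have h1 := (abs_sub_le_iff.1 hπ).2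
    nlinarith
  -- total count
  have htot : (primeIdealCount K x : ℝ) = ∑ C : ClassGroup (𝓞 K), (primeIdealClassCount K C x : ℝ) := by
    exact_mod_cast OneSidedShadows.primeIdealCount_eq_sum_classCount K x
  have hcardC : ((Finset.univ : Finset (ClassGroup (𝓞 K))).card : ℝ) = h := by
    rw [Finset.card_univ, hhdef, NumberField.classNumber]
  have hhpos : (0 : ℝ) < h := by exact_mod_cast NumberField.classNumber_pos (K := K)
  rcases H K hK with ⟨-, hA⟩ | ⟨χ₁, β₁, -, hβlo, hβhi, hzero, hB⟩
  · -- no exceptional zero: π_K ≥ (31/32) Li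
    have hC : ∀ C : ClassGroup (𝓞 K),
        31 / 32 * (offsetLogIntegral x / h) ≤ (primeIdealClassCount K C x : ℝ) :=
      fun C => key _ _ (hA C x hxc₁)
    have hπ : 31 / 32 * offsetLogIntegral x ≤ (primeIdealCount K x : ℝ) := by
      rw [htot]
      calc 31 / 32 * offsetLogIntegral x
          = ∑ C : ClassGroup (𝓞 K), 31 / 32 * (offsetLogIntegral x / h) := by
            rw [Finset.sum_const, nsmul_eq_mul, hcardC]; field_simp
        _ ≤ ∑ C : ClassGroup (𝓞 K), (primeIdealClassCount K C x : ℝ) :=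
            Finset.sum_le_sum fun C _ => hC C
    have hLix : 0 ≤ offsetLogIntegral x := by
      have h2 : (2:ℝ) ≤ x := by have := Real.add_one_le_exp (60:ℝ); linarith
      have := sub_mul_inv_log_pow_le_offsetLogIntegralPow 1 h2
      rw [offsetLogIntegralPow_one] at this
      have h0 : 0 ≤ (x - 2) * (Real.log x)⁻¹ ^ 1 := by
        apply mul_nonneg (by linarith); positivity
      linarith
    linarith only [hπ, hLix]
  · -- exceptional (χ₁, β₁)
    have hC : ∀ C : ClassGroup (𝓞 K), 31 / 32 *
        ((offsetLogIntegral x - ((χ₁ C : ℂ)).re * offsetLogIntegral (x ^ β₁)) / h)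
          ≤ (primeIdealClassCount K C x : ℝ) :=
      fun C => key _ _ (hB C x hxc₁)
    have hsumπ : 31 / 32 * ∑ C : ClassGroup (𝓞 K),
        (offsetLogIntegral x - ((χ₁ C : ℂ)).re * offsetLogIntegral (x ^ β₁)) / h
          ≤ (primeIdealCount K x : ℝ) := by
      rw [htot, Finset.mul_sum]
      exact Finset.sum_le_sum fun C _ => hC C
    have hsum : ∑ C : ClassGroup (𝓞 K),
        (offsetLogIntegral x - ((χ₁ C : ℂ)).re * offsetLogIntegral (x ^ β₁)) / (h : ℝ)
        = ((h : ℝ) * offsetLogIntegral x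
            - (∑ C : ClassGroup (𝓞 K), ((χ₁ C : ℂ)).re) * offsetLogIntegral (x ^ β₁)) / h := by
      rw [← Finset.sum_div, Finset.sum_sub_distrib, Finset.sum_const, nsmul_eq_mul, Finset.sum_mul,
        hcardC]
    -- Li(x) ≥ 0 and the two subcases
    have hx2 : (2:ℝ) ≤ x := by have := Real.add_one_le_exp (60:ℝ); linarith
    have hLix : 0 ≤ offsetLogIntegral x := by
      have := sub_mul_inv_log_pow_le_offsetLogIntegralPow 1 hx2
      rw [offsetLogIntegralPow_one] at this
      have h0 : 0 ≤ (x - 2) * (Real.log x)⁻¹ ^ 1 := by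
        apply mul_nonneg (by linarith); positivity
      linarith
    by_cases hχ1 : χ₁ = 1
    · -- χ₁ trivial: β₁ is a zero of ζ_K; the zero-free hypothesis pushes it left
      subst hχ1
      have hre : ∑ C : ClassGroup (𝓞 K), (((1 : ClassGroup (𝓞 K) →* ℂˣ) C : ℂ)).re = h := by
        simp only [MonoidHom.one_apply, Units.val_one, Complex.one_re, Finset.sum_const,
          nsmul_eq_mul, mul_one]
        exact hcardC
      rw [hre] at hsum
      have hmain : ∑ C : ClassGroup (𝓞 K),
          (offsetLogIntegral x - (((1 : ClassGroup (𝓞 K) →* ℂˣ) C : ℂ)).re *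
            offsetLogIntegral (x ^ β₁)) / (h : ℝ)
          = offsetLogIntegral x - offsetLogIntegral (x ^ β₁) := by
        rw [hsum]; field_simp
      rw [hmain] at hsumπ
      -- the zero-free interval
      have hβ1c : (β₁ : ℂ) ≠ 1 := by
        intro heq
        have := congrArg Complex.re heq
        simp at this
        linarith
      have hzeta : dedekindZetaCont K β₁ = 0 := by
        rw [← classGroupLFunction_one K hβ1c]; exact hzero
      set d : ℝ := ((NumberField.discr K).natAbs : ℝ) with hddef
      have hd_eq : d = |(NumberField.discr K : ℝ)| := by
        rw [hddef, Nat.cast_natAbs, Int.cast_abs]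
      have hd3 : (3 : ℝ) ≤ d := by
        have h2 := NumberField.abs_discr_gt_two hK
        rw [hd_eq, ← Int.cast_abs]
        exact_mod_cast (show (3:ℤ) ≤ |NumberField.discr K| by omega)
      have hdpos : 0 < d := by linarith
      have hlogd : 0 < Real.log d := Real.log_pos (by linarith)
      have hdQ : d ≤ Q := by
        rw [hQdef, ThornerZaman.condQn, hd_eq]
        have hn1 : (1:ℝ) ≤ (Module.finrank ℚ K : ℝ) ^ Module.finrank ℚ K :=
          one_le_pow₀ (by exact_mod_cast hK.le)
        have h0 : 0 ≤ |(NumberField.discr K : ℝ)| := abs_nonneg _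
        nlinarith
      have hlogdQ : Real.log d ≤ Real.log Q := Real.log_le_log hdpos hdQ
      have hβup : β₁ < 1 - c / Real.log d := by
        by_contra hcon
        rw [not_lt] at hcon
        exact hZ β₁ hcon hβhi hzeta
      -- (1 − β₁) log x ≥ 4
      have hgap : 4 ≤ (1 - β₁) * Real.log x := by
        have h1 : c / Real.log d ≤ 1 - β₁ := by linarith only [hβup]
        have hcd : 0 ≤ c / Real.log d := div_nonneg hc.le hlogd.le
        have h2 : c / Real.log d * (C₁ * Real.log d) = c * C₁ := by
          field_simp
        have h3 : c / Real.log d * (C₁ * Real.log d) ≤ c / Real.log d * Real.log x := by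
          apply mul_le_mul_of_nonneg_left _ hcd
          have : C₁ * Real.log d ≤ C₁ * Real.log Q := mul_le_mul_of_nonneg_left hlogdQ hC₁0
          linarith only [this, hlogx]
        have h4 : 4 ≤ c * C₁ := by
          have := (div_le_iff₀ hc).1 hC₁c; linarith only [this]
        have h5 : c / Real.log d * Real.log x ≤ (1 - β₁) * Real.log x :=
          mul_le_mul_of_nonneg_right h1 hlogxpos.le
        linarith only [h2, h3, h4, h5]
      -- x^{β₁} ≤ x / 50
      have hβpos : 0 < β₁ := by
        have hlQ1 : 1 ≤ Real.log Q := by linarith only [hlogQ2, hlog2]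
        have : 1 / (8 * Real.log Q) ≤ 1 / 8 :=
          one_div_le_one_div_of_le (by norm_num) (by linarith only [hlQ1])
        linarith only [this, hβlo]
      have hxβ : x ^ β₁ ≤ x / 50 := by
        have h1 : x ^ β₁ = x ^ (β₁ - 1) * x := by
          rw [← Real.rpow_add_one hxpos.ne' (β₁ - 1)]; norm_num
        have h2 : x ^ (β₁ - 1) ≤ Real.exp (-4) := by
          rw [Real.rpow_def_of_pos hxpos]
          apply Real.exp_le_exp.2
          nlinarith only [hgap]
        have h3 : Real.exp (-4) ≤ 1 / 50 := by
          rw [Real.exp_neg]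
          have h50 : (50:ℝ) ≤ Real.exp 4 := by
            have e1 : Real.exp 4 = Real.exp 1 ^ 4 := by rw [← Real.exp_nat_mul]; norm_num
            have e2 : (2.7 : ℝ) ≤ Real.exp 1 := le_of_lt (lt_trans (by norm_num) Real.exp_one_gt_d9)
            rw [e1]
            calc (50:ℝ) ≤ 2.7 ^ 4 := by norm_num
              _ ≤ Real.exp 1 ^ 4 := pow_le_pow_left₀ (by norm_num) e2 4
          rw [inv_eq_one_div, div_le_div_iff₀ (Real.exp_pos 4) (by norm_num)]
          linarith
        rw [h1]
        have : x ^ (β₁ - 1) * x ≤ (1 / 50) * x := by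
          apply mul_le_mul_of_nonneg_right (le_trans h2 h3) hxpos.le
        linarith only [this]
      -- Li x − Li x^β ≥ (x − x^β)/log x ≥ (49/50) x / log x
      have hdiff : (x - x ^ β₁) / Real.log x ≤ offsetLogIntegral x - offsetLogIntegral (x ^ β₁) :=
        sub_rpow_div_log_le_offsetLogIntegral_sub hx1 hβpos hβhi.le
      have hdiff2 : 49 / 50 * (x / Real.log x) ≤ (x - x ^ β₁) / Real.log x := by
        rw [mul_div_assoc', div_le_div_iff_of_pos_right hlogxpos]
        linarith only [hxβ]
      linarith only [hsumπ, hdiff, hdiff2, hLiup, hxl]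
    · -- χ₁ nontrivial: the β₁-terms cancel
      have hψ : (Units.coeHom ℂ).comp χ₁ ≠ 1 := by
        intro heq
        apply hχ1
        ext C
        have := DFunLike.congr_fun heq C
        simpa using this
      have hre : ∑ C : ClassGroup (𝓞 K), ((χ₁ C : ℂ)).re = 0 := by
        have h0 := sum_hom_units_eq_zero ((Units.coeHom ℂ).comp χ₁) hψ
        rw [← Complex.re_sum]
        have : ∑ C : ClassGroup (𝓞 K), (χ₁ C : ℂ) =
            ∑ C : ClassGroup (𝓞 K), ((Units.coeHom ℂ).comp χ₁) C := by
          apply Finset.sum_congr rfl; intro C _; rfl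
        rw [this, h0, Complex.zero_re]
      rw [hre] at hsum
      have hmain : ∑ C : ClassGroup (𝓞 K),
          (offsetLogIntegral x - ((χ₁ C : ℂ)).re * offsetLogIntegral (x ^ β₁)) / (h : ℝ)
          = offsetLogIntegral x := by
        rw [hsum, zero_mul, sub_zero, mul_div_assoc, mul_div_cancel₀ _ hhpos.ne']
      rw [hmain] at hsumπ
      linarith only [hsumπ, hLix]

/-! ### Glue 2 (PROVED): the reserve feeds the amplification hypothesis -/

/-- **Reserve primes inject into prime ideals of norm `≤ x`** (one degree-one prime above each;
distinct norms): `#{p ≤ x odd, p ∤ d_K, (d_K/p) = −1} ≤ π_K(x)`. [folklore] -/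
theorem ncard_reserve_le_primeIdealCount (h2 : CubicInertReserve) (K : Type) [Field K]
    [NumberField K] (hK : Module.finrank ℚ K = 3) (x : ℝ) :
    (Set.ncard {p : ℕ | p.Prime ∧ p ≠ 2 ∧ ¬ ((p : ℤ) ∣ NumberField.discr K) ∧
        jacobiSym (NumberField.discr K) p = -1 ∧ (p : ℝ) ≤ x} : ℝ) ≤ (primeIdealCount K x : ℝ) := by
  classical
  set R : Set ℕ := {p : ℕ | p.Prime ∧ p ≠ 2 ∧ ¬ ((p : ℤ) ∣ NumberField.discr K) ∧
      jacobiSym (NumberField.discr K) p = -1 ∧ (p : ℝ) ≤ x} with hRdef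
  have hmem : ∀ p : ℕ, p ∈ R → p.Prime ∧ p ≠ 2 ∧ ¬ ((p : ℤ) ∣ NumberField.discr K) ∧
      jacobiSym (NumberField.discr K) p = -1 ∧ (p : ℝ) ≤ x := by
    intro p hp
    simpa only [hRdef, Set.mem_setOf_eq] using hp
  have hch : ∀ p : ℕ, p ∈ R → ∃ P : Ideal (𝓞 K), P.IsPrime ∧ Ideal.absNorm P = p := by
    intro p hp
    obtain ⟨hp1, hp2, hpd, hj, -⟩ := hmem p hp
    exact h2 K hK p hp1 hp2 hpd hj
  choose! f hf using hch
  have hmaps : ∀ p ∈ R, f p ∈ primeIdealsLE K x := by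
    intro p hp
    obtain ⟨hP1, hP2⟩ := hf p hp
    obtain ⟨hp1, -, -, -, hpx⟩ := hmem p hp
    refine ⟨hP1, ?_, ?_⟩
    · intro hbot
      have h0 : Ideal.absNorm (f p) = 0 := Ideal.absNorm_eq_zero_iff.mpr hbot
      rw [hP2] at h0
      exact hp1.ne_zero h0
    · rw [hP2]
      exact hpx
  have hinj : Set.InjOn f R := by
    intro p hp q hq hpq
    have h := congrArg Ideal.absNorm hpq
    rw [(hf p hp).2, (hf q hq).2] at h
    exact h
  have hle : R.ncard ≤ (primeIdealsLE K x).ncard :=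
    Set.ncard_le_ncard_of_injOn f hmaps hinj (finite_primeIdealsLE K x)
  rw [primeIdealCount]
  exact_mod_cast hle

/-- **The cubic reserve lower bound**: for cubic `K` with non-square discriminant,
`(2/5)·Li(x) ≤ π_K(x)` for `x ≥ Q^{Cr}` (stubs 2 + 3; `4|d_K| ≤ Q = 27|d_K|`). [folklore] -/
theorem cubicReserveLower (hTZ : ThornerZaman2019_classPNT_hilbertClassField)
    (h2 : CubicInertReserve) (h3 : ThornerZaman2019_classPNT_hilbertClassField → InertPrimeCount) :
    ∃ Cr : ℝ, ∀ (K : Type) [Field K] [NumberField K], Module.finrank ℚ K = 3 →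
      ¬ IsSquare (NumberField.discr K) →
      ∀ x : ℝ, ThornerZaman.condQn K ^ Cr ≤ x →
        2 / 5 * offsetLogIntegral x ≤ (primeIdealCount K x : ℝ) := by
  obtain ⟨C, hC⟩ := h3 hTZ
  refine ⟨max C 0, fun K _ _ hK hsq x hx => ?_⟩
  have habs1 : (1 : ℝ) ≤ |(NumberField.discr K : ℝ)| := by
    rw [← Int.cast_abs]
    exact_mod_cast Int.one_le_abs (NumberField.discr_ne_zero K)
  have h4d : (1 : ℝ) ≤ 4 * |(NumberField.discr K : ℝ)| := by linarith
  have hQ : 4 * |(NumberField.discr K : ℝ)| ≤ ThornerZaman.condQn K := by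
    have h0 := abs_nonneg (NumberField.discr K : ℝ)
    have h1 : ThornerZaman.condQn K = |(NumberField.discr K : ℝ)| * 27 := by
      simp only [ThornerZaman.condQn, hK]; norm_num
    rw [h1]; linarith
  have hx' : (4 * |((NumberField.discr K : ℤ) : ℝ)|) ^ C ≤ x := by
    calc (4 * |(NumberField.discr K : ℝ)|) ^ C
        ≤ (4 * |(NumberField.discr K : ℝ)|) ^ (max C 0) :=
          Real.rpow_le_rpow_of_exponent_le h4d (le_max_left _ _)
      _ ≤ ThornerZaman.condQn K ^ (max C 0) :=
          Real.rpow_le_rpow (by positivity) hQ (le_max_right _ _)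
      _ ≤ x := hx
  exact (hC (NumberField.discr K) hsq x hx').trans (ncard_reserve_le_primeIdealCount h2 K hK x)

/-! ### Glue 3 (PROVED): the lower shadow at every degree, and the crux -/

/-- **The cubic lower shadow from TZ alone (stubs 2–5; NO Stark, no field hypothesis)**:
`29·Li(x) ≤ 32·π_K(x)` for every cubic `K` and `x ≥ Q^{C₁}` — non-square `d_K`: reserve
(stubs 2, 3) fed into the amplification (stub 4); square `d_K`: stub 5 through
`lowerShadow_of_TZ_zeroFree`. [folklore] -/
theorem lowerShadowAt_three (h1 : ThornerZaman2019_classPNT_hilbertClassField)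
    (h2 : CubicInertReserve) (h3 : ThornerZaman2019_classPNT_hilbertClassField → InertPrimeCount)
    (h4 : ThornerZaman2019_classPNT_hilbertClassField → ReserveAmplification)
    (h5 : CyclicCubicZeroFree) :
    ∃ C₁ : ℝ, ∀ (K : Type) [Field K] [NumberField K], Module.finrank ℚ K = 3 →
      ∀ x : ℝ, ThornerZaman.condQn K ^ C₁ ≤ x →
        29 * offsetLogIntegral x ≤ 32 * (primeIdealCount K x : ℝ) := by
  obtain ⟨Cr, hCr⟩ := cubicReserveLower h1 h2 h3
  obtain ⟨C₁, hC₁⟩ := h4 h1 3 (by norm_num) (2 / 5) (by norm_num) Cr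
  obtain ⟨c, hc, hZ⟩ := h5
  obtain ⟨C₂, hC₂⟩ := lowerShadow_of_TZ_zeroFree h1 hc
  refine ⟨max C₁ C₂, fun K _ _ hKn x hx => ?_⟩
  have hK : 1 < Module.finrank ℚ K := by rw [hKn]; norm_num
  have hQ1 : 1 ≤ ThornerZaman.condQn K := (ThornerZaman.one_lt_condQn K hK).le
  by_cases hsq : IsSquare (NumberField.discr K)
  · exact hC₂ K hK (hZ K hKn hsq) x
      (le_trans (Real.rpow_le_rpow_of_exponent_le hQ1 (le_max_right _ _)) hx)
  · exact hC₁ K hKn (fun y hy => hCr K hKn hsq y hy) x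
      (le_trans (Real.rpow_le_rpow_of_exponent_le hQ1 (le_max_left _ _)) hx)

/-- **Degree-local composition** (the counting half of one-sided-shadows, verbatim from
`OneSidedShadows.degreeOnePrimesEscape_of_shadows` with `hlow n h1n` replaced by a hypothesis AT
degree `n ≥ 3`): F_up + the lower shadow at degree `n` give the crux inequality at degree `n`.
Outside `M` = (degree-one primes) − (degree-one primes in `M`) `≥ (29/32)Li − n·π(√x) − (33/64)Li`,
against `π(x) ≤ 2 log 4 · x/log x + √x` (Mathlib `Chebyshev.pi_le_log4_mul_div`). [folklore] -/
theorem escapeAt_of_shadowAt (hup : OneSidedShadows.SubgroupUpperShadow) {n : ℕ} (hn3 : 3 ≤ n)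
    (hlow : ∃ C₁ : ℝ, ∀ (K : Type) [Field K] [NumberField K], Module.finrank ℚ K = n →
      (∀ F : IntermediateField ℚ K, Module.finrank ℚ F ≠ 2) →
      ∀ x : ℝ, ThornerZaman.condQn K ^ C₁ ≤ x →
        29 * offsetLogIntegral x ≤ 32 * (primeIdealCount K x : ℝ)) :
    ∃ C : ℕ, ∀ (K : Type) [Field K] [NumberField K], Module.finrank ℚ K = n →
      (∀ F : IntermediateField ℚ K, Module.finrank ℚ F ≠ 2) →
      ∀ x : ℕ, |NumberField.discr K| ^ C ≤ (x : ℤ) →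
      ∀ M : Subgroup (ClassGroup (𝓞 K)), M ≠ ⊤ →
        Nat.primeCounting x ≤ 8 * Set.ncard {P : Ideal (𝓞 K) | P.IsPrime ∧
          (Ideal.absNorm P).Prime ∧ Ideal.absNorm P ≤ x ∧
          ∃ hP : P ∈ nonZeroDivisors (Ideal (𝓞 K)), ClassGroup.mk0 ⟨P, hP⟩ ∉ M} := by
  classical
  have h1n : 1 < n := by omega
  obtain ⟨C₀, hC₀⟩ := hup
  obtain ⟨C₁, hC₁⟩ := hlow
  set C' : ℝ := max (max C₀ C₁) 1 with hC'def
  refine ⟨(⌈C'⌉₊ + 50) * (1 + n ^ 2) + n, ?_⟩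
  intro K _ _ hKn hnq x hx M hM
  have hK : 1 < Module.finrank ℚ K := by rw [hKn]; exact h1n
  set Cn : ℕ := (⌈C'⌉₊ + 50) * (1 + n ^ 2) + n with hCndef
  set xr : ℝ := (x : ℝ) with hxrdef
  set d : ℝ := |(NumberField.discr K : ℝ)| with hddef
  set Q : ℝ := ThornerZaman.condQn K with hQdef
  -- d ≥ 3, Q = d n^n ≤ d^(1+n²)
  have hd3 : (3:ℝ) ≤ d := by
    have h2 := NumberField.abs_discr_gt_two hK
    rw [hddef, ← Int.cast_abs]
    exact_mod_cast (show (3:ℤ) ≤ |NumberField.discr K| by omega)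
  have hd1 : (1:ℝ) ≤ d := by linarith
  have hQ : Q = d * (n : ℝ) ^ n := by rw [hQdef, ThornerZaman.condQn, hKn]
  have hnn : (n : ℝ) ^ n ≤ d ^ (n ^ 2) := by
    have h1 : (n : ℝ) ≤ 3 ^ n := by
      exact_mod_cast (Nat.lt_pow_self (by norm_num : 1 < 3) (n := n)).le
    calc (n:ℝ) ^ n ≤ (3 ^ n) ^ n := pow_le_pow_left₀ (by positivity) h1 n
      _ = 3 ^ (n ^ 2) := by rw [← pow_mul]; ring_nf
      _ ≤ d ^ (n ^ 2) := pow_le_pow_left₀ (by norm_num) hd3 _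
  have hQle : Q ≤ d ^ (1 + n ^ 2) := by
    rw [hQ, pow_add, pow_one]
    exact mul_le_mul_of_nonneg_left hnn (by linarith)
  have hQ12 : 12 ≤ Q := ThornerZaman.twelve_le_condQn (K := K) hK
  have hQ1 : 1 ≤ Q := by linarith
  -- x ≥ d^Cn ≥ 3^Cn
  have hx_d : d ^ Cn ≤ xr := by
    have h1 : ((|NumberField.discr K| ^ Cn : ℤ) : ℝ) ≤ ((x : ℤ) : ℝ) := by exact_mod_cast hx
    rw [Int.cast_pow, Int.cast_abs, Int.cast_natCast] at h1
    exact h1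
  have hx_3 : (3:ℝ) ^ Cn ≤ xr := le_trans (pow_le_pow_left₀ (by norm_num) hd3 Cn) hx_d
  -- Q^{C'} ≤ xr
  have hQC' : Q ^ C' ≤ xr := by
    have h1 : Q ^ C' ≤ Q ^ ((⌈C'⌉₊ + 50 : ℕ) : ℝ) := by
      apply Real.rpow_le_rpow_of_exponent_le hQ1
      have := Nat.le_ceil C'
      push_cast
      linarith
    rw [Real.rpow_natCast] at h1
    calc Q ^ C' ≤ Q ^ (⌈C'⌉₊ + 50) := h1
      _ ≤ (d ^ (1 + n ^ 2)) ^ (⌈C'⌉₊ + 50) := pow_le_pow_left₀ (by linarith) hQle _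
      _ = d ^ ((1 + n ^ 2) * (⌈C'⌉₊ + 50)) := by rw [← pow_mul]
      _ ≤ d ^ Cn := pow_le_pow_right₀ hd1 (by rw [hCndef]; nlinarith)
      _ ≤ xr := hx_d
  have hC₀le : C₀ ≤ C' := le_trans (le_max_left _ _) (le_max_left _ _)
  have hC₁le : C₁ ≤ C' := le_trans (le_max_right _ _) (le_max_left _ _)
  have hQC₀ : Q ^ C₀ ≤ xr := le_trans (Real.rpow_le_rpow_of_exponent_le hQ1 hC₀le) hQC'
  have hQC₁ : Q ^ C₁ ≤ xr := le_trans (Real.rpow_le_rpow_of_exponent_le hQ1 hC₁le) hQC'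
  have hupK := hC₀ K hK xr hQC₀ M
  have hlowK := hC₁ K hKn hnq xr hQC₁
  -- sizes
  have hCn50 : 50 * (1 + n ^ 2) ≤ Cn := by rw [hCndef]; nlinarith
  have hxbig : (100 * ((n:ℝ) + 1)) ^ 4 ≤ xr := by
    have h1 : ((100 * (n + 1)) ^ 4 : ℕ) ≤ 3 ^ Cn := OneSidedShadows.pow_bound n Cn hCn50
    have h2 : (((100 * (n + 1)) ^ 4 : ℕ) : ℝ) ≤ ((3 ^ Cn : ℕ) : ℝ) := by exact_mod_cast h1
    push_cast at h2
    linarith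
  have hsize := OneSidedShadows.size_ineq n hxbig
  have hx3' : (3:ℝ) ≤ xr := by
    have : (3:ℝ) ^ 1 ≤ 3 ^ Cn := pow_le_pow_right₀ (by norm_num) (by omega)
    linarith
  have hxpos : 0 < xr := by linarith
  have hx1 : 1 < xr := by linarith
  have hx2 : 2 ≤ xr := by linarith
  have hlogx : 1 ≤ Real.log xr := by
    rw [Real.le_log_iff_exp_le hxpos]
    have := Real.exp_one_lt_d9
    linarith
  have hlogpos : 0 < Real.log xr := by linarith
  -- Li ≥ (x-2)/log x ≥ x/log x − 2
  have hLi : xr / Real.log xr - 2 ≤ offsetLogIntegral xr := by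
    have h1 := sub_mul_inv_log_pow_le_offsetLogIntegralPow 1 hx2
    rw [offsetLogIntegralPow_one, pow_one, ← div_eq_mul_inv] at h1
    have h2 : xr / Real.log xr - 2 ≤ (xr - 2) / Real.log xr := by
      rw [sub_div]
      have : 2 / Real.log xr ≤ 2 := by
        rw [div_le_iff₀ hlogpos]; nlinarith
      linarith
    linarith
  -- π(x) ≤ 2 log 4 · x/log x + √x
  have hA0 : 0 ≤ xr / Real.log xr := by positivity
  have hpi : (Nat.primeCounting x : ℝ) ≤ 2.7726 * (xr / Real.log xr) + Real.sqrt xr := by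
    have h1 := Chebyshev.pi_le_log4_mul_div hx1
    rw [hxrdef, Nat.floor_natCast] at h1
    have hlogsqrt : Real.log (Real.sqrt (x:ℝ)) = Real.log (x:ℝ) / 2 := Real.log_sqrt (by positivity)
    rw [hlogsqrt] at h1
    have e3 : Real.log 4 * (x:ℝ) / (Real.log (x:ℝ) / 2) = 2 * Real.log 4 * ((x:ℝ) / Real.log (x:ℝ)) := by
      field_simp
    rw [e3] at h1
    have hlog4 : Real.log 4 < 1.3863 := by
      have : Real.log 4 = 2 * Real.log 2 := by
        rw [show (4:ℝ) = 2 ^ 2 by norm_num, Real.log_pow]; norm_num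
      rw [this]; have := Real.log_two_lt_d9; linarith
    have h4 : 2 * Real.log 4 * (xr / Real.log xr) ≤ 2.7726 * (xr / Real.log xr) :=
      mul_le_mul_of_nonneg_right (by linarith) hA0
    rw [hxrdef] at h4 ⊢
    linarith
  -- counting
  set Sout : Set (Ideal (𝓞 K)) := {P : Ideal (𝓞 K) | P.IsPrime ∧ (Ideal.absNorm P).Prime ∧
      Ideal.absNorm P ≤ x ∧ ∃ hP : P ∈ nonZeroDivisors (Ideal (𝓞 K)), ClassGroup.mk0 ⟨P, hP⟩ ∉ M}
    with hSout
  set Sin : Set (Ideal (𝓞 K)) := {P : Ideal (𝓞 K) | P.IsPrime ∧ (Ideal.absNorm P : ℝ) ≤ xr ∧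
      ∃ hP : P ∈ (Ideal (𝓞 K))⁰, ClassGroup.mk0 ⟨P, hP⟩ ∈ M} with hSin
  set D : Set (Ideal (𝓞 K)) := {P : Ideal (𝓞 K) | P.IsPrime ∧ P ≠ ⊥ ∧ (Ideal.absNorm P).Prime ∧
      Ideal.absNorm P ≤ x} with hD
  have hfin : (Sout ∪ Sin).Finite := by
    refine (Ideal.finite_setOf_absNorm_le (S := 𝓞 K) x).subset ?_
    rintro P (⟨-, -, h3, -⟩ | ⟨-, h2, -⟩)
    · exact h3
    · show Ideal.absNorm P ≤ x
      have h2' : (Ideal.absNorm P : ℝ) ≤ (x : ℝ) := h2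
      exact_mod_cast h2'
  have hcover : D ⊆ Sout ∪ Sin := by
    rintro P ⟨h1, h2, h3, h4⟩
    have hP : P ∈ (Ideal (𝓞 K))⁰ := mem_nonZeroDivisors_of_ne_zero h2
    by_cases hc : ClassGroup.mk0 ⟨P, hP⟩ ∈ M
    · right
      refine ⟨h1, ?_, hP, hc⟩
      show (Ideal.absNorm P : ℝ) ≤ (x : ℝ)
      exact_mod_cast h4
    · left; exact ⟨h1, h3, h4, hP, hc⟩
  have hcount : Set.ncard D ≤ Set.ncard Sout + Set.ncard Sin :=
    le_trans (Set.ncard_le_ncard hcover hfin) (Set.ncard_union_le _ _)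
  have hDeq : Set.ncard D = ∑ p ∈ (Finset.Icc 0 x).filter Nat.Prime, normPrimeIdealCount K p :=
    OneSidedShadows.ncard_degOne_eq_sum K x
  have hdeg := OneSidedShadows.primeIdealCount_le_degOne_add K x
  rw [hKn, ← hDeq] at hdeg
  -- π(√x) ≤ √x + 1
  have hpisqrt : (Nat.primeCounting (Nat.sqrt x) : ℝ) ≤ Real.sqrt xr + 1 := by
    have h1 : Nat.primeCounting (Nat.sqrt x) ≤ Nat.sqrt x + 1 := by
      rw [Nat.primeCounting, Nat.primeCounting']
      exact Nat.count_le _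
    have h2 : ((Nat.sqrt x : ℕ) : ℝ) ≤ Real.sqrt xr := by
      rw [hxrdef, Real.le_sqrt (by positivity) (by positivity)]
      exact_mod_cast Nat.sqrt_le' x
    calc (Nat.primeCounting (Nat.sqrt x) : ℝ) ≤ (Nat.sqrt x : ℝ) + 1 := by exact_mod_cast h1
      _ ≤ Real.sqrt xr + 1 := by linarith
  -- index ≥ 2 (this is where `M ≠ ⊤` is load-bearing: Negative/WithoutProperFalse)
  have hidx : (2 : ℝ) ≤ M.index := by
    have h1 : M.index ≠ 1 := fun h => hM (Subgroup.index_eq_one.mp h)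
    have h2 : M.index ≠ 0 := Subgroup.index_ne_zero_of_finite
    exact_mod_cast (show 2 ≤ M.index by omega)
  have hin0 : (0:ℝ) ≤ Set.ncard Sin := Nat.cast_nonneg _
  have hup' : 64 * (Set.ncard Sin : ℝ) ≤ 33 * offsetLogIntegral xr := by
    have : 32 * 2 * (Set.ncard Sin : ℝ) ≤ 32 * (M.index : ℝ) * (Set.ncard Sin : ℝ) := by
      apply mul_le_mul_of_nonneg_right _ hin0
      linarith
    linarith
  -- assembly in ℝ
  have e1 : ((primeIdealCount K xr : ℕ) : ℝ) ≤
      (Set.ncard D : ℝ) + (n : ℝ) * Real.sqrt xr + n := by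
    have h1 : ((primeIdealCount K (x:ℝ) : ℕ) : ℝ) ≤
        ((Set.ncard D + n * Nat.primeCounting (Nat.sqrt x) : ℕ) : ℝ) := by
      exact_mod_cast hdeg
    push_cast at h1
    have hn0 : (0:ℝ) ≤ n := Nat.cast_nonneg n
    have h2 : (n:ℝ) * (Nat.primeCounting (Nat.sqrt x) : ℝ) ≤ n * (Real.sqrt xr + 1) :=
      mul_le_mul_of_nonneg_left hpisqrt hn0
    have h3 : (n:ℝ) * (Real.sqrt xr + 1) = n * Real.sqrt xr + n := by ring
    rw [h3] at h2
    rw [hxrdef] at h2 ⊢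
    linarith
  have e2 : (Set.ncard D : ℝ) ≤ Set.ncard Sout + Set.ncard Sin := by exact_mod_cast hcount
  have hsqrt0 : 0 ≤ Real.sqrt xr := Real.sqrt_nonneg _
  have hgoal : (Nat.primeCounting x : ℝ) ≤ 8 * (Set.ncard Sout : ℝ) := by
    linarith [hlowK, hup', e1, e2, hLi, hpi, hsize, hsqrt0]
  exact_mod_cast hgoal


/-- **`LowerPITShadow` from the stubs**: `n = 2` is vacuous (`K` is its own quadratic subfield);
`n = 3` splits on `IsSquare d_K` — non-square: reserve (stubs 2, 3) fed into the amplification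
(stub 4), TZ only; square: stub 5 through `lowerShadow_of_TZ_zeroFree`; `n ≥ 4`: stub 6 through
`lowerShadow_of_TZ_zeroFree`. [folklore] -/
theorem lowerPITShadow_of_stubs (h1 : ThornerZaman2019_classPNT_hilbertClassField)
    (h2 : CubicInertReserve) (h3 : ThornerZaman2019_classPNT_hilbertClassField → InertPrimeCount)
    (h4 : ThornerZaman2019_classPNT_hilbertClassField → ReserveAmplification)
    (h5 : CyclicCubicZeroFree) (h6 : StarkFromDegreeFour) : OneSidedShadows.LowerPITShadow := by
  intro n hn
  rcases Nat.lt_or_ge n 4 with hn4 | hn4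
  · interval_cases n
    · -- n = 2: the no-quadratic-subfield hypothesis is self-refuting
      refine ⟨0, fun K _ _ hKn hnq x hx => ?_⟩
      exact (hnq ⊤ (by rw [IntermediateField.finrank_top', hKn])).elim
    · -- n = 3: reserve + amplification (non-square d_K), doubling (square d_K); no field hypothesis
      obtain ⟨C₁, hC₁⟩ := lowerShadowAt_three h1 h2 h3 h4 h5
      exact ⟨C₁, fun K _ _ hKn _ x hx => hC₁ K hKn x hx⟩
  · -- n ≥ 4: the residue
    obtain ⟨c, hc, hZ⟩ := h6 n hn4
    obtain ⟨C₂, hC₂⟩ := lowerShadow_of_TZ_zeroFree h1 hc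
    refine ⟨C₂, fun K _ _ hKn hnq x hx => ?_⟩
    have hK : 1 < Module.finrank ℚ K := by rw [hKn]; omega
    exact hC₂ K hK (hZ K hKn hnq) x hx

/-- **THE SKELETON THEOREM: `DegreeOnePrimesEscape` from the six registered stubs** (pure logic,
no `sorry`): one-sided-shadows' composition with F_up from stub 1 and F_low assembled by
`lowerPITShadow_of_stubs`. -/
theorem DegreeOnePrimesEscape_of (h1 : Registered.stub_thornerZamanHCF)
    (h2 : Registered.stub_cubicInertReserve) (h3 : Registered.stub_inertPrimeCount)
    (h4 : Registered.stub_reserveAmplification) (h5 : Registered.stub_cyclicCubicZeroFree)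
    (h6 : Registered.stub_starkFromDegreeFour) :
    Summit.QuantumAdvantage.QuantumAdvantage.Theses.LinnikCubicClassGroups.DegreeOnePrimesEscape :=
  OneSidedShadows.degreeOnePrimesEscape_of_shadows (OneSidedShadows.subgroupUpperShadow_of_TZ h1)
    (lowerPITShadow_of_stubs h1 h2 h3 h4 h5 h6)

/-- Wiring check: the registered stubs feed `DegreeOnePrimesEscape_of` as stated. -/
example : Summit.QuantumAdvantage.QuantumAdvantage.Theses.LinnikCubicClassGroups.DegreeOnePrimesEscape :=
  DegreeOnePrimesEscape_of stub_thornerZamanHCF stub_cubicInertReserve stub_inertPrimeCount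
    stub_reserveAmplification stub_cyclicCubicZeroFree stub_starkFromDegreeFour

/-! ### The payoff, kernel-checked modulo stubs 2–5: the route's `n = 3` slice is TZ-only -/

/-- Odd degree excludes quadratic subfields (tower law; Disproof §3). [folklore] -/
theorem noQuadraticSubfield_of_finrank_eq_three (K : Type) [Field K] [NumberField K]
    (hK : Module.finrank ℚ K = 3) : ∀ F : IntermediateField ℚ K, Module.finrank ℚ F ≠ 2 := by
  intro F hF
  have hdvd : Module.finrank ℚ F ∣ Module.finrank ℚ K :=
    Dvd.intro _ (Module.finrank_mul_finrank ℚ F K)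
  rw [hF, hK] at hdvd
  omega

/-- **The cubic slice of the crux from Thorner–Zaman ALONE** (what `PureCubicClassGroupFBQP`
consumes, cf. `Disproof.cubic_escape_of_crux`): for every cubic number field `K` — no field
hypothesis, no Stark fact, no Artin `L`-function — `∃ C, ∀ x ≥ |d_K|^C, ∀ M < Cl(K) proper,
π(x) ≤ 8 · #{P : N P prime ≤ x, [P] ∉ M}`, from TZ and stubs 2–5.  This is the theorem a tenure
split `DegreeOnePrimesEscape ⇐ {n = 3 slice, n ≥ 4}` would file for the consumer. -/
theorem cubicEscape_of_TZ_reserve (h1 : ThornerZaman2019_classPNT_hilbertClassField)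
    (h2 : CubicInertReserve) (h3 : ThornerZaman2019_classPNT_hilbertClassField → InertPrimeCount)
    (h4 : ThornerZaman2019_classPNT_hilbertClassField → ReserveAmplification)
    (h5 : CyclicCubicZeroFree) :
    ∃ C : ℕ, ∀ (K : Type) [Field K] [NumberField K], Module.finrank ℚ K = 3 →
      ∀ x : ℕ, |NumberField.discr K| ^ C ≤ (x : ℤ) →
      ∀ M : Subgroup (ClassGroup (𝓞 K)), M ≠ ⊤ →
        Nat.primeCounting x ≤ 8 * Set.ncard {P : Ideal (𝓞 K) | P.IsPrime ∧
          (Ideal.absNorm P).Prime ∧ Ideal.absNorm P ≤ x ∧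
          ∃ hP : P ∈ nonZeroDivisors (Ideal (𝓞 K)), ClassGroup.mk0 ⟨P, hP⟩ ∉ M} := by
  obtain ⟨C₁, hC₁⟩ := lowerShadowAt_three h1 h2 h3 h4 h5
  obtain ⟨C, hC⟩ := escapeAt_of_shadowAt (OneSidedShadows.subgroupUpperShadow_of_TZ h1) (le_refl 3)
    ⟨C₁, fun K _ _ hKn _ x hx => hC₁ K hKn x hx⟩
  exact ⟨C, fun K _ _ hK x hx M hM =>
    hC K hK (noQuadraticSubfield_of_finrank_eq_three K hK) x hx M hM⟩

/-! ### Scratch checks: the residue is a slice of the named fact; Negative lemmas; `Leans on` -/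

/-- STUB 6 is a SLICE of the in-tree named Stark fact (`c = 1/(4·n!)`): the residue costs
nothing conditionally. -/
theorem starkFromDegreeFour_of_named (h : Stark1974_dedekindZeta_ne_zero_of_noQuadraticSubfield) :
    StarkFromDegreeFour := by
  intro n _
  refine ⟨1 / (4 * (n.factorial : ℝ)), by positivity, fun K _ _ hK hnq σ hσ hσ1 => ?_⟩
  refine h K hnq σ ?_ hσ1
  subst hK
  have : 1 / (4 * ((Module.finrank ℚ K).factorial : ℝ)) / Real.log ((NumberField.discr K).natAbs : ℝ)
      = 1 / (4 * ((Module.finrank ℚ K).factorial : ℝ) *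
          Real.log ((NumberField.discr K).natAbs : ℝ)) := by
    rw [div_div]
  linarith [this]

/-- STUB 5 is likewise implied by the named Stark fact (a cubic field has no quadratic subfield),
so the stub set never asks for more than TZ + Stark: the line can only LOWER the trust base. -/
theorem cyclicCubicZeroFree_of_named (h : Stark1974_dedekindZeta_ne_zero_of_noQuadraticSubfield) :
    CyclicCubicZeroFree := by
  refine ⟨1 / (4 * ((3 : ℕ).factorial : ℝ)), by positivity, fun K _ _ hK _ σ hσ hσ1 => ?_⟩
  refine h K (noQuadraticSubfield_of_finrank_eq_three K hK) σ ?_ hσ1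
  rw [hK]
  have : 1 / (4 * ((3 : ℕ).factorial : ℝ)) / Real.log ((NumberField.discr K).natAbs : ℝ)
      = 1 / (4 * ((3 : ℕ).factorial : ℝ) * Real.log ((NumberField.discr K).natAbs : ℝ)) := by
    rw [div_div]
  linarith [this]

/-- Sanity: with BOTH named facts the six stubs are inhabited except stubs 2–4 (the line's own
provable-now content) — i.e. the skeleton never exceeds one-sided-shadows' trust base
`{TZ, Stark}` and drops `Stark` exactly on the `n = 3` slice. -/
example (hTZ : ThornerZaman2019_classPNT_hilbertClassField)
    (hSt : Stark1974_dedekindZeta_ne_zero_of_noQuadraticSubfield)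
    (h2 : CubicInertReserve) (h3 : InertPrimeCount) (h4 : ReserveAmplification) :
    Summit.QuantumAdvantage.QuantumAdvantage.Theses.LinnikCubicClassGroups.DegreeOnePrimesEscape :=
  DegreeOnePrimesEscape_of hTZ h2 (fun _ => h3) (fun _ => h4) (cyclicCubicZeroFree_of_named hSt)
    (starkFromDegreeFour_of_named hSt)

/-- Landed Negative lemma (p69750): `M ≠ ⊤` is load-bearing — honoured by the composition. -/
example : ¬ Literature.Uncategorized.DegreeOnePrimesEscapeWithoutProper :=
  Summit.QuantumAdvantage.QuantumAdvantage.Theorems.DegreeOnePrimesEscape.Negative.degreeOnePrimesEscape_false_without_proper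

/-- Landed sign lemma (p70790, Disproof §10): a nontrivial exceptional character never depletes
an escape count — the reason the line only has to fight `χ₁ = 1`. -/
example {G : Type*} [CommGroup G] [Fintype G] (M : Subgroup G) [DecidablePred (· ∈ M)]
    (χ : G →* ℂˣ) (hχ : χ ≠ 1) :
    (∑ C ∈ Finset.univ.filter (· ∉ M), ((χ C : ℂˣ) : ℂ)).re ≤ 0 :=
  Summit.QuantumAdvantage.QuantumAdvantage.Theorems.DegreeOnePrimesEscape.Negative.re_sum_filter_not_mem_nonpos
    M χ hχ

/-- `Leans on` of stubs 3/5 resolve and are theorems: the prime ideal theorem is PROVED … -/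
example : primeIdealTheorem := primeIdealTheorem_holds

/-- … and the uniform simplicity of the near-`1` real zero in degree `3` is PROVED. -/
example : ∃ c : ℝ, 0 < c ∧ ∀ (K : Type) [Field K] [NumberField K], Module.finrank ℚ K = 3 →
    ∀ β : ℝ, (2 : ℕ∞) ≤ analyticOrderAt (dedekindZeta₁ K) β →
      β ≤ 1 - c / (Real.log ((NumberField.discr K).natAbs : ℝ) + Real.log 4) :=
  exists_realZero_simple_dedekindZeta₁ 3

end Summit.QuantumAdvantage.QuantumAdvantage.Cruxes.DegreeOnePrimesEscape.ReservePrimesAbsorption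

end
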